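import Literature.Computability.AlgebraicComplexity.TavenasHomogeneousProofs
import Literature.Computability.AlgebraicComplexity.HomogeneousDepthFour

/-!
# Tavenas' depth reduction lands in genuine depth-4 (`ΣΠΣΠ`) circuits

Companion of `TavenasHomogeneousProofs.lean` (discharge of Tavenas 2015, Thm. 1, homogeneous
form, for the product-depth-2 measure `homProductDepthCircuitSize 2`) and of
`HomogeneousDepthFour.lean` (Kumar–Saraf's depth-4 discipline `ArithCircuit.IsDepthFour`, measure
`homDepthFourCircuitSize`). The circuit built there, `DepthReduction.sigmaPiCircuit` — one product
gate per monomial (layer 1), one sum gate per piece (layer 2), one product gate per term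
(layer 3), one output sum gate (layer 4) — is a `ΣΠΣΠ` circuit in Kumar–Saraf's sense, so the
same bound holds for the (larger) depth-4 measure:

* `gateLayers_layer`, `sigmaPiDepth_sigmaPiCircuit_le` (`≤ 4`), `isDepthFour_sigmaPiCircuit`;
* `exists_depthFour_circuit_of_slp` — the homogeneous expansion of a straight-line program
  (`exists_hom_circuit_of_slp`) realised by a depth-4 circuit of at most `sizeBound N d s t`
  gates;
* `homDepthFourCircuitSize_le_of_isVPFamily` — **Tavenas 2015, Thm. 1 for the depth-4 measure**:
  for a `VP` family `f` of homogeneous polynomials over any commutative semiring there is `c`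
  with `homDepthFourCircuitSize (f n) ≤ (n + 2) ^ (c ⌊√deg fₙ⌋ + c)` for all `n`. Together with
  Kumar–Saraf's Cor. 1.3 as printed (`DepthReductionChasmDepthFour`,
  `Literature/Barriers/ValiantsHypothesis/DepthReductionChasmDepthFour.lean`) this is the two-sided
  "chasm" `n^{Θ(√n)}` in one and the same measure.

Nothing new is asserted; the proofs re-run the assembly of `TavenasHomogeneousProofs.lean` with
the extra bookkeeping of layers.

## References

* S. Tavenas, *Improved bounds for reduction to depth 4 and depth 3*, Inform. and Comput. 240
  (2015) 2–11, Thm. 1 ("computed by a `ΣΠ^{[O(α)]}ΣΠ^{[β]}` circuit"; "if `f` is homogeneous, it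
  will be also the case for `C`"), §2 (`ΣΠΣΠ` circuits), §6 (Lemma 3).
* M. Kumar, S. Saraf, *On the power of homogeneous depth 4 arithmetic circuits*, SIAM J. Comput.
  46 (2017) 336–387, §3 (depth-4 circuits), Cor. 1.3.
* M. Agrawal, V. Vinay, *Arithmetic circuits: a chasm at depth four*, FOCS 2008.
-/

noncomputable section

open MvPolynomial

namespace Literature.Computability.AlgebraicComplexity.DepthReduction

universe u v

/-! ### Layers of a layered circuit -/

section Layers

variable {k : Type u} {σ : Type v}

open ArithCircuit

/-- Layers of a layer: if every gate of `B` refers only to gates of `A`, the layers of `A ++ B`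
are the layers of `A` followed by the layers of the gates of `B` computed against those.
[folklore] -/
theorem gateLayers_layer (A B : List (Gate k σ))
    (hB : ∀ g ∈ B, ∀ u ∈ g.args, u.RefsBelow A.length) :
    gateLayers (A ++ B) = gateLayers A ++
      B.map fun g => g.layerStep ((g.args.map (Operand.depthIn (gateLayers A))).foldr max 0) := by
  induction B using List.reverseRecOn with
  | nil => simp
  | append_singleton B g ih =>
    rw [← List.append_assoc, gateLayers_append_singleton, ih fun g' hg' => hB g' (by simp [hg'])]
    rw [List.map_append, List.map_singleton, List.append_assoc]
    have hfold : (g.args.map (Operand.depthIn (gateLayers A ++ B.map fun g =>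
        g.layerStep ((g.args.map (Operand.depthIn (gateLayers A))).foldr max 0)))).foldr max 0 =
        (g.args.map (Operand.depthIn (gateLayers A))).foldr max 0 := by
      congr 1
      apply List.map_congr_left
      intro u hu
      rw [depthIn_append_of_refsBelow]
      rw [gateLayers_length]
      exact hB g (by simp) u hu
    rw [hfold]

/-- The layer of a product gate over operands of layers `≤ 2 a` is `≤ 2 a + 1`. [folklore] -/
theorem layerStep_prod_le {args : List (Operand k σ)} {s a : ℕ} (h : s ≤ 2 * a) :
    (Gate.prod args).layerStep s ≤ 2 * a + 1 := by
  simp only [Gate.layerStep]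
  split_ifs <;> omega

/-- The layer of a sum gate over operands of layers `≤ 2 a + 1` is `≤ 2 a + 2`. [folklore] -/
theorem layerStep_sum_le {args : List (k × Operand k σ)} {s a : ℕ} (h : s ≤ 2 * a + 1) :
    (Gate.sum args).layerStep s ≤ 2 * a + 2 := by
  simp only [Gate.layerStep]
  split_ifs <;> omega

end Layers

/-! ### The `ΣΠΣΠ` builder is a depth-4 circuit -/

section Builder

variable {k : Type u} {σ : Type v} [CommSemiring k] [DecidableEq σ]
variable (T W : ℕ) (p : Fin T → Fin W → MvPolynomial σ k) (ms : List (σ →₀ ℕ))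

open ArithCircuit

omit [DecidableEq σ] in
/-- **`sigmaPiCircuit` has `ΣΠ`-depth `≤ 4`**: monomial gates (products of variables) lie in
layer `1`, piece gates (sums of those) in layer `≤ 2`, term gates (products of pieces) in layer
`≤ 3`, the output sum in layer `≤ 4`. [cite: KumarSaraf2017, §3; Tavenas2015, §2] -/
theorem sigmaPiDepth_sigmaPiCircuit_le : (sigmaPiCircuit T W p ms).sigmaPiDepth ≤ 4 := by
  unfold ArithCircuit.sigmaPiDepth
  have h1 : AllLe 1 (gateLayers (layerM ms : List (Gate k σ))) := by
    have := gateLayers_layer ([] : List (Gate k σ)) (layerM ms) (refs_layerM ms)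
    simp only [List.nil_append] at this
    rw [this]
    intro x hx
    simp only [gateLayers, List.foldl_nil, List.nil_append, List.mem_map] at hx
    obtain ⟨g, hg, rfl⟩ := hx
    simp only [layerM, List.mem_map] at hg
    obtain ⟨m, -, rfl⟩ := hg
    have h0 : ((monomialGate m : Gate k σ).args.map
        (Operand.depthIn ([] : List ℕ))).foldr max 0 ≤ 2 * 0 :=
      foldr_max_le fun x hx => by
        obtain ⟨u, hu, rfl⟩ := List.mem_map.1 hx
        obtain ⟨j, rfl⟩ := args_monomialGate m u hu
        exact le_rfl
    exact layerStep_prod_le h0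
  have h2 : AllLe 2 (gateLayers (layerM ms ++ layerP T W p ms)) := by
    rw [gateLayers_layer _ _ (refs_layerP T W p ms)]
    intro x hx
    rcases List.mem_append.1 hx with hx | hx
    · exact (h1 x hx).trans (by norm_num)
    · simp only [List.mem_map] at hx
      obtain ⟨g, hg, rfl⟩ := hx
      simp only [layerP, List.mem_map] at hg
      obtain ⟨q, -, rfl⟩ := hg
      exact layerStep_sum_le (a := 0) (foldr_max_le fun x hx => by
        obtain ⟨u, -, rfl⟩ := List.mem_map.1 hx
        exact depthIn_le h1 u)
  have h3 : AllLe 3 (gateLayers (layerM ms ++ layerP T W p ms ++ layerT T W ms)) := by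
    rw [gateLayers_layer _ _ (refs_layerT T W p ms)]
    intro x hx
    rcases List.mem_append.1 hx with hx | hx
    · exact (h2 x hx).trans (by norm_num)
    · simp only [List.mem_map] at hx
      obtain ⟨g, hg, rfl⟩ := hx
      simp only [layerT, List.mem_map] at hg
      obtain ⟨τ, -, rfl⟩ := hg
      exact layerStep_prod_le (a := 1) (foldr_max_le fun x hx => by
        obtain ⟨u, -, rfl⟩ := List.mem_map.1 hx
        exact depthIn_le h2 u)
  have h4 : AllLe 4 (gateLayers (sigmaPiCircuit T W p ms).gates) := by
    simp only [sigmaPiCircuit]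
    rw [gateLayers_layer _ _ (refs_top T W p ms)]
    intro x hx
    rcases List.mem_append.1 hx with hx | hx
    · exact (h3 x hx).trans (by norm_num)
    · simp only [List.map_singleton, List.mem_singleton] at hx
      subst hx
      exact layerStep_sum_le (a := 1) (foldr_max_le fun x hx => by
        obtain ⟨u, -, rfl⟩ := List.mem_map.1 hx
        exact depthIn_le h3 u)
  exact depthIn_le h4 _

omit [DecidableEq σ] in
/-- `sigmaPiCircuit` satisfies Kumar–Saraf's depth-4 discipline. [cite: KumarSaraf2017, §3] -/
theorem isDepthFour_sigmaPiCircuit : (sigmaPiCircuit T W p ms).IsDepthFour :=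
  sigmaPiDepth_sigmaPiCircuit_le T W p ms

/-- **The homogeneous `ΣΠΣΠ` builder, depth-4 form**: `Σ_{τ < T} Π_{π < W} p τ π` with all
supports inside `U`, all pieces homogeneous and a homogeneous total, has a homogeneous depth-4
circuit with `#U + T · W + T + 1` gates. [cite: Tavenas2015, §6, Lemma 3; KumarSaraf2017, §3] -/
theorem exists_depthFour_circuit_sum_prod (U : Finset (σ →₀ ℕ)) (hp : ∀ τ π, (p τ π).support ⊆ U)
    (hhom : ∀ τ π, ∃ e, (p τ π).IsHomogeneous e)
    (hsum : ∃ e, (∑ τ : Fin T, ∏ π : Fin W, p τ π).IsHomogeneous e) :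
    ∃ C : ArithCircuit k σ, C.eval = ∑ τ : Fin T, ∏ π : Fin W, p τ π ∧ C.IsDepthFour ∧
      C.IsHomogeneousCircuit ∧ C.size = U.card + T * W + T + 1 := by
  refine ⟨sigmaPiCircuit T W p U.toList, ?_, isDepthFour_sigmaPiCircuit T W p _, ?_, ?_⟩
  · exact eval_sigmaPiCircuit T W p _ (Finset.nodup_toList U) (by simpa using hp)
  · exact isHomogeneousCircuit_sigmaPiCircuit T W p _ (Finset.nodup_toList U) (by simpa using hp)
      hhom hsum
  · rw [size_sigmaPiCircuit, Finset.length_toList]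

end Builder

/-! ### Assembly -/

section Assembly

variable {k : Type u} [CommSemiring k] {σ : Type v}

/-- A homogeneous value of degree `d` of a straight-line program of length `s` over `N` variables
has a homogeneous DEPTH-4 circuit with at most `sizeBound N d s t` gates (`t ≥ 1`) — the circuit
of `exists_hom_circuit_of_slp`, which is a `sigmaPiCircuit`.
[cite: Tavenas2015, Thm. 1 and Lemma 3 (homogeneous case); AgrawalVinay2008] -/
theorem exists_depthFour_circuit_of_slp [Fintype σ] [DecidableEq σ] (S : SLP k σ) {i : ℕ}
    (hi : i < S.len) {d t : ℕ} (hd : (S.val i).IsHomogeneous d) (ht : 1 ≤ t) :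
    ∃ C : ArithCircuit k σ, C.eval = S.val i ∧ C.IsDepthFour ∧ C.IsHomogeneousCircuit ∧
      C.size ≤ sizeBound (Fintype.card σ) d S.len t := by
  obtain ⟨L, hsum, hlen, hT⟩ :=
    S.exists_sum_prod_component_hom d ht ⟨i, hi⟩ ⟨d, Nat.lt_succ_self d⟩
  have hsum' : (L.map List.prod).sum = S.val i := by
    rw [hsum]
    exact homogeneousComponent_eq_self hd
  set W := 1 + 4 * (8 * d / (t + 1)) with hW
  let p : Fin L.length → Fin W → MvPolynomial σ k := fun τ π => (L[τ.val]).getD π.val 1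
  let U : Finset (σ →₀ ℕ) := (Finset.univ : Finset (Fin L.length × Fin W)).biUnion
    fun x => (p x.1 x.2).support
  have hp : ∀ τ π, (p τ π).support ⊆ U := fun τ π =>
    Finset.subset_biUnion_of_mem (fun x : Fin L.length × Fin W => (p x.1 x.2).support)
      (Finset.mem_univ (τ, π))
  have hpτ : ∀ τ : Fin L.length, ∏ π : Fin W, p τ π = (L[τ.val]).prod := fun τ =>
    prod_getD_one _ W (hT _ (List.getElem_mem _)).1
  have htot : ∑ τ : Fin L.length, ∏ π : Fin W, p τ π = S.val i := by
    rw [← hsum']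
    simp only [hpτ]
    exact Fin.sum_univ_fun_getElem L List.prod
  have hhom : ∀ τ π, ∃ e, (p τ π).IsHomogeneous e := by
    intro τ π
    rcases getD_one_mem_or (L[τ.val]) π.val with h | h
    · obtain ⟨e, -, he⟩ := (hT _ (List.getElem_mem _)).2 _ h
      exact ⟨e, he⟩
    · refine ⟨0, ?_⟩
      simp only [p]
      rw [h]
      exact isHomogeneous_one σ k
  have hsumhom : ∃ e, (∑ τ : Fin L.length, ∏ π : Fin W, p τ π).IsHomogeneous e :=
    ⟨d, htot ▸ hd⟩
  obtain ⟨C, hC, h4, hhc, hsize⟩ :=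
    exists_depthFour_circuit_sum_prod L.length W p U hp hhom hsumhom
  refine ⟨C, hC.trans htot, h4, hhc, ?_⟩
  rw [hsize, sizeBound]
  have hU : U.card ≤ (t + 1) * (Fintype.card σ + t) ^ t := by
    apply card_le_of_degree_le U ht
    intro m hm
    simp only [U, Finset.mem_biUnion, Finset.mem_univ, true_and] at hm
    obtain ⟨⟨τ, π⟩, hm⟩ := hm
    refine (le_totalDegree hm).trans ?_
    rcases getD_one_mem_or (L[τ.val]) π.val with h | h
    · obtain ⟨e, he, hhe⟩ := (hT _ (List.getElem_mem _)).2 _ h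
      exact hhe.totalDegree_le.trans he
    · simp only [p] at hm ⊢
      rw [h, totalDegree_one]
      exact Nat.zero_le _
  have hlen' : L.length ≤ (d + 1) * ((4 * S.len * (d + 1) ^ 2) *
      (4 * S.len * (d + 1) ^ 2)) ^ (8 * d / (t + 1)) :=
    hlen.trans (Nat.le_mul_of_pos_left _ (Nat.succ_pos d))
  have hLW : L.length * W ≤ ((d + 1) * ((4 * S.len * (d + 1) ^ 2) *
      (4 * S.len * (d + 1) ^ 2)) ^ (8 * d / (t + 1))) * W := Nat.mul_le_mul_right _ hlen'
  rw [← hW]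
  omega

/-- **Tavenas' depth reduction for `VP` families of homogeneous polynomials, depth-4 measure**,
over any commutative semiring: for a `VP` family `f` of homogeneous polynomials there is `c` with
`homDepthFourCircuitSize (f n) ≤ (n + 2) ^ (c ⌊√deg fₙ⌋ + c)` for all `n` — the circuit `C` of
Tavenas 2015, Thm. 1 is a homogeneous `ΣΠΣΠ` circuit, i.e. satisfies `ArithCircuit.IsDepthFour`.
[cite: Tavenas2015, Thm. 1; AgrawalVinay2008; KumarSaraf2017, §3] -/
theorem homDepthFourCircuitSize_le_of_isVPFamily {σ : ℕ → Type v} [∀ n, Fintype (σ n)]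
    (f : ∀ n, MvPolynomial (σ n) k) (hf : IsVPFamily f)
    (hfhom : ∀ n, (f n).IsHomogeneous (f n).totalDegree) :
    ∃ c : ℕ, ∀ n : ℕ,
      homDepthFourCircuitSize (f n) ≤ ((n + 2 : ℕ∞) ^ (c * Nat.sqrt ((f n).totalDegree) + c)) := by
  classical
  obtain ⟨⟨⟨a1, h1⟩, ⟨a2, h2⟩⟩, ⟨a3, h3⟩⟩ := hf
  set a := a1 + a2 + a3 with ha
  set E := a + 2 with hE
  refine ⟨50 * E + 40, fun n => ?_⟩
  have hgh := hfhom n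
  set B := n + 2 with hB
  set g := f n with hg
  set d := g.totalDegree with hd
  set t := Nat.sqrt d with htd
  -- a homogeneous depth-4 circuit of size ≤ B ^ ((48E+32) t + (50E+40))
  suffices hC : ∃ C : ArithCircuit k (σ n), C.eval = g ∧ C.IsDepthFour ∧
      C.IsHomogeneousCircuit ∧ C.size ≤ B ^ ((48 * E + 32) * t + (50 * E + 40)) by
    obtain ⟨C, hCe, hCd, hCh, hCs⟩ := hC
    refine (homDepthFourCircuitSize_le hCe hCd hCh).trans ?_
    have h50 : (48 * E + 32) * t + (50 * E + 40) ≤ (50 * E + 40) * t + (50 * E + 40) := by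
      nlinarith [Nat.zero_le E, Nat.zero_le t]
    have := hCs.trans (Nat.pow_le_pow_right (by omega) h50)
    calc (C.size : ℕ∞) ≤ ((B ^ ((50 * E + 40) * t + (50 * E + 40)) : ℕ) : ℕ∞) := by
          exact_mod_cast this
      _ = ((n + 2 : ℕ∞) ^ ((50 * E + 40) * t + (50 * E + 40))) := by push_cast [hB]; ring_nf
  have hBpos : 1 ≤ B ^ ((48 * E + 32) * t + (50 * E + 40)) := Nat.one_le_pow _ _ (by omega)
  by_cases hd0 : d = 0
  · refine ⟨ArithCircuit.ofConst (g.coeff 0), ?_, ArithCircuit.isDepthFour_ofConst _,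
      ArithCircuit.isHomogeneousCircuit_ofConst _, ?_⟩
    · rw [ArithCircuit.eval_ofConst]; exact (totalDegree_eq_zero_iff_eq_C.1 hd0).symm
    · rw [ArithCircuit.size_ofConst]; exact Nat.zero_le _
  have ht : 1 ≤ t := by rw [htd, Nat.le_sqrt]; omega
  obtain ⟨P, hfan, hcomp, hsize⟩ := ArithCircuit.exists_computes_size_eq_complexity g
  obtain ⟨S, hlen, hcases⟩ := exists_slp P hfan
  rw [show P.eval = g from hcomp] at hcases
  rcases hcases with ⟨i, hi, hgi⟩ | ⟨j, hgj⟩ | ⟨c, hgc⟩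
  · have hdi : (S.val i).IsHomogeneous d := by rw [← hgi]; exact hgh
    obtain ⟨C, hCe, hCd, hCh, hCs⟩ := exists_depthFour_circuit_of_slp S hi hdi ht
    refine ⟨C, hCe.trans hgi.symm, hCd, hCh, hCs.trans ?_⟩
    have hN : Fintype.card (σ n) ≤ 2 * B ^ a := le_two_mul_pow (h1 n) (by omega)
    have hdd : d ≤ 2 * B ^ a := le_two_mul_pow (h2 n) (by omega)
    have hs : S.len ≤ 2 * B ^ a := by
      rw [hlen, hsize]; exact le_two_mul_pow (h3 n) (by omega)
    have h4 := four_mul_pow_le B a (by omega)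
    have htle : t ≤ d := Nat.sqrt_le_self d
    apply sizeBound_le (B := B) (E := E) (by omega)
    · rw [hE]; omega
    · rw [hE]; omega
    · rw [hE]; omega
    · rw [hE]; omega
    · exact Nat.lt_succ_sqrt d
  · refine ⟨ArithCircuit.ofVar j, ?_, ArithCircuit.isDepthFour_ofVar _,
      ArithCircuit.isHomogeneousCircuit_ofVar _, ?_⟩
    · rw [ArithCircuit.eval_ofVar, hgj]
    · rw [ArithCircuit.size_ofVar]; exact Nat.zero_le _
  · refine ⟨ArithCircuit.ofConst c, ?_, ArithCircuit.isDepthFour_ofConst _,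
      ArithCircuit.isHomogeneousCircuit_ofConst _, ?_⟩
    · rw [ArithCircuit.eval_ofConst, hgc]
    · rw [ArithCircuit.size_ofConst]; exact Nat.zero_le _

/-- The depth-4 bound at the field `ℂ`, in the shape of the tree's Tavenas facts
(`homProductDepthCircuitSize_two_le_of_isVPFamily`), for the users of the barrier catalogue.
[cite: Tavenas2015, Thm. 1] -/
theorem homDepthFourCircuitSize_le_of_isVPFamily_complex {σ : ℕ → Type} [∀ n, Fintype (σ n)]
    (f : ∀ n, MvPolynomial (σ n) ℂ) (hf : IsVPFamily f)
    (hfhom : ∀ n, (f n).IsHomogeneous (f n).totalDegree) :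
    ∃ c : ℕ, ∀ n : ℕ,
      homDepthFourCircuitSize (f n) ≤ ((n + 2 : ℕ∞) ^ (c * Nat.sqrt ((f n).totalDegree) + c)) :=
  homDepthFourCircuitSize_le_of_isVPFamily f hf hfhom

end Assembly

end Literature.Computability.AlgebraicComplexity.DepthReduction
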